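import Mathlib
import HarnessLib

/-!
# TwoNotchDefectCounting — LEMMA F (law-free defect counting for the cyclic u-subword) of the PERMISSIVE two-notch book
# (STAGING; nogo gen 22, `PBOOK-ADDENDUM-5-RIDER-A.md` §1; two-party since census-2 g28 `UALT-B.md`)

search for candidate a priori estimates; no regularity claim.

Setting (prose dictionary, RIDER A §1): `σ` = the cyclic sign sequence of the u-chords of a state (t-chords and the directors skipped), written
here as a `List ℤ` with entries `±1` read cyclically; `F(σ)` = the number of cyclically adjacent EQUAL pairs (`F = 0` ⟺ `σ` alternates ⟺ the u-half
of CONJECTURE LCA holds at that state).  A u-BIRTH (at `M` or at an emitter `−t`) inserts an adjacent pair `(x, x̄ = −x)` into a slot of `σ`, between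
the cyclically nearest u-letters `a` (before the host) and `b` (after); a u-MEAL deletes an adjacent pair `(y, ȳ)` whose outer neighbours are `a`, `b`.
Because `F` is rotation invariant (`cycDefects_rotate`), a slot insertion anywhere is an insertion at the seam of a rotated word
(`cycDefects_insert_anywhere`), so the seam form below is the general one.

What is kernel-checked here (elementary list combinatorics, `[ours]`):
* `linDefects`, `cycDefects` — the linear and the cyclic count of adjacent equal pairs; `linDefects_append_single` (appending one letter adds the
  bracket `[last = new]`), `cycDefects_eq` (cyclic = linear + seam bracket), `cycDefects_rotate_one`, `cycDefects_rotate` (rotation invariance),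
  `cycDefects_insert_anywhere` / `cycDefects_append_comm` (reduction of any slot to the seam);
* `lemmaF_birth` — LEMMA F for a birth: `F(σ ++ [x, x̄]) − F(σ) = [a = x] + [x̄ = b] − [a = b]` (`a` = last, `b` = head of the nonempty `σ`, any
  `x ≠ 0`); `lemmaF_meal` — the same identity read as a deletion: `ΔF(meal) = [a = b] − [a = y] − [ȳ = b]`;
* the four sign cases over `±1`: `lemmaF_birth_alternating_slot` (`b = −a`: `ΔF = 2[x = a]` — `0` MATCHED, `+2` MISMATCHED), `lemmaF_birth_defect_slot`
  (`b = a`: `ΔF = 0`), `lemmaF_meal_values` (`ΔF(meal) ∈ {0, −2}`) and `lemmaF_meal_repairing_iff` (`ΔF = −2` iff `a = y ∧ b = ȳ`: the REPAIRING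
  pattern `y y ȳ ȳ` around the eater); `lemmaF_birth_empty` (`F([x, x̄]) = 0`, the degenerate slot);
* `closed_cycle_balance` — on a closed event cycle (the changes, each in `{0, +2, −2}`, sum to zero) the mismatched births and the repairing meals are
  equinumerous.
NOT checked by Lean (prose, RIDER A §1 / ADDENDUM-5): that u-events act on the u-subword exactly by such slot insertions / deletions (the event
grammar), and the identification MATCHED = 'chirality A iff the nearest u-letter before the host is +u'.  Nothing is claimed about Navier–Stokes.
-/

namespace Summit.NavierStokesRegularity.FunctionalMining.TwoNotchDefectCounting

/-- Iverson bracket. -/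
def br (p : Prop) [Decidable p] : ℤ := if p then 1 else 0

/-- `br p = 1` when `p` holds. -/
@[simp] theorem br_true {p : Prop} [Decidable p] (h : p) : br p = 1 := by simp [br, h]
/-- `br p = 0` when `p` fails. -/
@[simp] theorem br_false {p : Prop} [Decidable p] (h : ¬p) : br p = 0 := by simp [br, h]

/-- Number of adjacent equal pairs of a list read LINEARLY. -/
def linDefects : List ℤ → ℕ
  | a :: b :: l => (if a = b then 1 else 0) + linDefects (b :: l)
  | _ => 0

/-- The empty word has no linear defects. -/
@[simp] theorem linDefects_nil : linDefects [] = 0 := rfl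
/-- A one-letter word has no linear defects. -/
@[simp] theorem linDefects_single (a : ℤ) : linDefects [a] = 0 := rfl
/-- Unfolding `linDefects` on a word with at least two letters. -/
@[simp] theorem linDefects_cons_cons (a b : ℤ) (l : List ℤ) :
    linDefects (a :: b :: l) = (if a = b then 1 else 0) + linDefects (b :: l) := rfl

/-- Appending one letter `c` adds the pair (last, `c`). -/
theorem linDefects_append_single : ∀ (l : List ℤ) (c : ℤ),
    linDefects (l ++ [c]) = linDefects l + (if l.getLast? = some c then 1 else 0)
  | [], c => by simp
  | [a], c => by simp
  | a :: b :: l, c => by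
      have ih := linDefects_append_single (b :: l) c
      simp only [List.cons_append] at ih
      simp only [List.cons_append, linDefects_cons_cons, ih, List.getLast?_cons_cons]
      omega

/-- Number of adjacent equal pairs of a list read CYCLICALLY (`F` of LEMMA F): close the cycle by appending the head. -/
def cycDefects : List ℤ → ℕ
  | [] => 0
  | a :: l => linDefects (a :: l ++ [a])

/-- The empty word has no cyclic defects. -/
@[simp] theorem cycDefects_nil : cycDefects [] = 0 := rfl

/-- cyclic count = linear count + the seam pair (last, head). -/
theorem cycDefects_eq (a : ℤ) (l : List ℤ) :
    cycDefects (a :: l) = linDefects (a :: l) + (if (a :: l).getLast? = some a then 1 else 0) := by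
  have h := linDefects_append_single (a :: l) a
  simp only [List.cons_append] at h
  exact h

/-- The last letter of `b :: (l ++ [a])` is `a`. -/
theorem getLast?_cons_append_single : ∀ (b : ℤ) (l : List ℤ) (a : ℤ), (b :: (l ++ [a])).getLast? = some a
  | b, [], a => by simp
  | b, c :: l, a => by
      rw [List.cons_append, List.getLast?_cons_cons]
      exact getLast?_cons_append_single c l a

/-- Rotation by one letter does not change `F`. -/
theorem cycDefects_rotate_one (a : ℤ) (l : List ℤ) : cycDefects (l ++ [a]) = cycDefects (a :: l) := by
  cases l with
  | nil => rfl
  | cons b l =>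
      rw [List.cons_append, cycDefects_eq, cycDefects_eq, linDefects_cons_cons]
      have h1 := linDefects_append_single (b :: l) a
      simp only [List.cons_append] at h1
      rw [h1, getLast?_cons_append_single, List.getLast?_cons_cons]
      by_cases hab : a = b
      · subst hab; simp only [if_true]; omega
      · simp only [Option.some.injEq, hab, if_false]; omega

/-- Rotation invariance of `F`. -/
theorem cycDefects_rotate (l : List ℤ) (k : ℕ) : cycDefects (l.rotate k) = cycDefects l := by
  induction k generalizing l with
  | zero => simp
  | succ k ih =>
      cases l with
      | nil => simp
      | cons a l => rw [List.rotate_cons_succ, ih, cycDefects_rotate_one]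

/-- Cyclic words that differ by a rotation of their two halves have the same `F`. -/
theorem cycDefects_append_comm (l₁ l₂ : List ℤ) : cycDefects (l₁ ++ l₂) = cycDefects (l₂ ++ l₁) := by
  have h := cycDefects_rotate (l₁ ++ l₂) l₁.length
  rw [List.rotate_append_length_eq] at h
  exact h.symm

/-- A slot insertion anywhere is a seam insertion of the rotated word: inserting `[x, x̄]` between `l₁` and `l₂` of the cyclic word `l₁ ++ l₂`
gives the same `F` as appending `[x, x̄]` to `l₂ ++ l₁` (whose last letter is the cyclic predecessor and whose head is the cyclic successor of
the slot). -/
theorem cycDefects_insert_anywhere (l₁ l₂ : List ℤ) (x y : ℤ) :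
    cycDefects (l₁ ++ [x, y] ++ l₂) = cycDefects (l₂ ++ l₁ ++ [x, y]) := by
  rw [List.append_assoc, cycDefects_append_comm l₁ ([x, y] ++ l₂), List.append_assoc,
    cycDefects_append_comm [x, y] (l₂ ++ l₁)]

/-- LEMMA F, birth (seam form, general by `cycDefects_insert_anywhere`): inserting the twin pair `(x, x̄)`, `x̄ = −x`, into the slot after the
last letter `a` and before the head `b` of a nonempty cyclic word changes `F` by `[a = x] + [x̄ = b] − [a = b]`. -/
theorem lemmaF_birth (b : ℤ) (l : List ℤ) (x : ℤ) (hx : x ≠ 0) :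
    (cycDefects ((b :: l) ++ [x, -x]) : ℤ) - cycDefects (b :: l)
      = br ((b :: l).getLast (List.cons_ne_nil b l) = x) + br (-x = b) - br ((b :: l).getLast (List.cons_ne_nil b l) = b) := by
  -- unfold the cyclic counts into linear counts + brackets
  have e1 : cycDefects ((b :: l) ++ [x, -x]) = linDefects (b :: l ++ [x, -x] ++ [b]) := by
    simp [cycDefects, List.append_assoc]
  have e2 : linDefects (b :: l ++ [x, -x] ++ [b])
      = linDefects (b :: l) + (if (b :: l).getLast? = some x then 1 else 0) + (if x = -x then 1 else 0)
        + (if -x = b then 1 else 0) := by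
    have h1 := linDefects_append_single (b :: l) x
    have h2 := linDefects_append_single (b :: l ++ [x]) (-x)
    have h3 := linDefects_append_single (b :: l ++ [x] ++ [-x]) b
    have g2 : (b :: l ++ [x]).getLast? = some x := getLast?_cons_append_single b l x
    have g3 : (b :: l ++ [x] ++ [-x]).getLast? = some (-x) := by
      have := getLast?_cons_append_single b (l ++ [x]) (-x)
      simpa [List.append_assoc] using this
    rw [g2] at h2
    rw [g3] at h3
    have s : b :: l ++ [x, -x] ++ [b] = b :: l ++ [x] ++ [-x] ++ [b] := by simp [List.append_assoc]
    rw [s, h3, h2, h1]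
    simp only [Option.some.injEq]
  have e3 := cycDefects_eq b l
  have hxx : ¬ x = -x := by omega
  have gl : (b :: l).getLast? = some ((b :: l).getLast (List.cons_ne_nil b l)) := List.getLast?_eq_some_getLast _
  rw [e1, e2, e3, gl]
  simp only [Option.some.injEq, hxx, if_false, add_zero, br]
  split_ifs <;> push_cast <;> omega

/-- LEMMA F, meal: deleting an adjacent pair `(y, ȳ)` whose outer neighbours are `a` (before) and `b` (after) changes `F` by
`[a = b] − [a = y] − [ȳ = b]` — the birth identity read backwards. -/
theorem lemmaF_meal (b : ℤ) (l : List ℤ) (y : ℤ) (hy : y ≠ 0) :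
    (cycDefects (b :: l) : ℤ) - cycDefects ((b :: l) ++ [y, -y])
      = br ((b :: l).getLast (List.cons_ne_nil b l) = b) - br ((b :: l).getLast (List.cons_ne_nil b l) = y) - br (-y = b) := by
  have h := lemmaF_birth b l y hy
  omega

/-- The degenerate slot: a twin pair born into an EMPTY u-word gives `F = 0`. -/
theorem lemmaF_birth_empty (x : ℤ) (hx : x ≠ 0) : cycDefects [x, -x] = 0 := by
  have hxx : ¬ x = -x := by omega
  have hxx' : ¬ -x = x := by omega
  simp [cycDefects, hxx, hxx']

/-- Birth into an ALTERNATING slot (`b = −a`): `ΔF = 2[x = a]` — `0` if the left twin continues the alternation (MATCHED), `+2` if not (MISMATCHED). -/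
theorem lemmaF_birth_alternating_slot (b : ℤ) (l : List ℤ) (x : ℤ) (hb : b = 1 ∨ b = -1) (hx : x = 1 ∨ x = -1)
    (halt : (b :: l).getLast (List.cons_ne_nil b l) = -b) :
    (cycDefects ((b :: l) ++ [x, -x]) : ℤ) - cycDefects (b :: l) = 2 * br (x = -b) := by
  have hx0 : x ≠ 0 := by omega
  rw [lemmaF_birth b l x hx0, halt]
  unfold br
  rcases hb with rfl | rfl <;> rcases hx with rfl | rfl <;> simp

/-- Birth into a DEFECT slot (`b = a`): `ΔF = 0` always (the defect moves, it is neither created nor destroyed). -/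
theorem lemmaF_birth_defect_slot (b : ℤ) (l : List ℤ) (x : ℤ) (hb : b = 1 ∨ b = -1) (hx : x = 1 ∨ x = -1)
    (hdef : (b :: l).getLast (List.cons_ne_nil b l) = b) :
    (cycDefects ((b :: l) ++ [x, -x]) : ℤ) - cycDefects (b :: l) = 0 := by
  have hx0 : x ≠ 0 := by omega
  rw [lemmaF_birth b l x hx0, hdef]
  unfold br
  rcases hb with rfl | rfl <;> rcases hx with rfl | rfl <;> simp

/-- A meal changes `F` by `0` or `−2` (signs `±1`). -/
theorem lemmaF_meal_values (b : ℤ) (l : List ℤ) (y : ℤ) (hb : b = 1 ∨ b = -1) (hy : y = 1 ∨ y = -1)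
    (ha : (b :: l).getLast (List.cons_ne_nil b l) = 1 ∨ (b :: l).getLast (List.cons_ne_nil b l) = -1) :
    (cycDefects (b :: l) : ℤ) - cycDefects ((b :: l) ++ [y, -y]) = 0 ∨
      (cycDefects (b :: l) : ℤ) - cycDefects ((b :: l) ++ [y, -y]) = -2 := by
  have hy0 : y ≠ 0 := by omega
  rw [lemmaF_meal b l y hy0]
  generalize (b :: l).getLast (List.cons_ne_nil b l) = a at ha ⊢
  unfold br
  rcases hb with rfl | rfl <;> rcases hy with rfl | rfl <;> rcases ha with rfl | rfl <;> simp

/-- REPAIRING meals: `ΔF(meal) = −2` iff `a = y` and `b = ȳ` (the pattern `y y ȳ ȳ` around the eater). -/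
theorem lemmaF_meal_repairing_iff (b : ℤ) (l : List ℤ) (y : ℤ) (hb : b = 1 ∨ b = -1) (hy : y = 1 ∨ y = -1)
    (ha : (b :: l).getLast (List.cons_ne_nil b l) = 1 ∨ (b :: l).getLast (List.cons_ne_nil b l) = -1) :
    (cycDefects (b :: l) : ℤ) - cycDefects ((b :: l) ++ [y, -y]) = -2 ↔
      ((b :: l).getLast (List.cons_ne_nil b l) = y ∧ b = -y) := by
  have hy0 : y ≠ 0 := by omega
  rw [lemmaF_meal b l y hy0]
  generalize (b :: l).getLast (List.cons_ne_nil b l) = a at ha ⊢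
  unfold br
  rcases hb with rfl | rfl <;> rcases hy with rfl | rfl <;> rcases ha with rfl | rfl <;> simp

/-- On a CLOSED event cycle the changes of `F` (each `0`, `+2` or `−2` by the lemmas above) sum to zero, so the MISMATCHED births (`+2`) and the
REPAIRING meals (`−2`) are equinumerous. -/
theorem closed_cycle_balance (ds : List ℤ) (h : ∀ d ∈ ds, d = 0 ∨ d = 2 ∨ d = -2) (hs : ds.sum = 0) :
    ds.count 2 = ds.count (-2) := by
  have key : ∀ (es : List ℤ), (∀ d ∈ es, d = 0 ∨ d = 2 ∨ d = -2) →
      es.sum = 2 * (es.count 2 : ℤ) - 2 * (es.count (-2) : ℤ) := by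
    intro es
    induction es with
    | nil => simp
    | cons d es ih =>
        intro hes
        have hd := hes d (by simp)
        have ih' := ih (fun e he => hes e (by simp [he]))
        rw [List.sum_cons, ih', List.count_cons, List.count_cons]
        rcases hd with rfl | rfl | rfl <;> simp <;> ring
  have := key ds h
  rw [hs] at this
  omega

end Summit.NavierStokesRegularity.FunctionalMining.TwoNotchDefectCounting
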